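import Mathlib.Tactic
import HarnessLib

/-!
# Kozma–Nitzan's Question 8 — DICHOTOMY D at importers: the Chebyshev lemma for θ-monotone importers (gen 42 reconnaissance)

Support file (`--supports stmt-CriticalPhenomena-4575`, closed crux; independent mathematics on Kozma–Nitzan's Question 8,
arXiv:2401.12397 §5.5 p. 36), prover `prim-ineq-gen-6` (gen 42).  No definitions, no named facts, no sorries; standard axioms.
Memo `run/shared/lean/prim/prim-ineq-gen-6/FINDING-G42.md` §3: DICHOTOMY D needs (X1) only at importers; at an importer `t` the children's
`δ`-masses `z_k = r_{k,t}δ_k/p_t` are sign-ordered (positives first) and `Σ_k z_k < −e_t/p_t ≤ 0`; the A-side sum is `X^δ_t = Σ_k τ_k z_k` with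
`τ_k = A_F/M_F ∈ [0,1]`.  LEMMA θ′: if `τ` is non-decreasing along the children then `X^δ_t ≤ τ_κ·Σ_k z_k < 0` — the termwise comparison below.

* `kImp_term` — the termwise step: `z ≥ 0 ∧ τ ≤ τ₀` or `z ≤ 0 ∧ τ₀ ≤ τ` gives `τ·z ≤ τ₀·z`;
* `kImp_cheb` — the finite-sum form `Σ_{k<t} τ_k z_k ≤ τ₀·Σ_{k<t} z_k` under the termwise hypothesis;
* `kImp_assembly` — with the importer inequality `Σ_k z_k < −e ≤ 0` and `τ₀ ≥ 0`: `Σ_k τ_k z_k ≤ −τ₀·e ≤ 0` ((X1) at a θ-monotone importer).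
[cite: KozmaNitzan2024, Question 8 (§5.5 p. 36)]
-/

namespace Summit.CriticalPhenomena.PercolationContinuityZ3.Theorems

namespace PocketCert

open Finset

/-- **Termwise Chebyshev step.**  If either `0 ≤ z` and `τ ≤ τ₀`, or `z ≤ 0` and `τ₀ ≤ τ`, then `τ·z ≤ τ₀·z`.
[cite: KozmaNitzan2024, Question 8 (§5.5 p. 36)] -/
theorem kImp_term (τ τ₀ z : ℝ) (h : (0 ≤ z ∧ τ ≤ τ₀) ∨ (z ≤ 0 ∧ τ₀ ≤ τ)) : τ * z ≤ τ₀ * z := by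
  rcases h with ⟨hz, hτ⟩ | ⟨hz, hτ⟩
  · exact mul_le_mul_of_nonneg_right hτ hz
  · exact mul_le_mul_of_nonpos_right hτ hz

/-- **LEMMA θ′ (finite-sum form).**  If for every child `k < t` either (`z_k ≥ 0` and `τ_k ≤ τ₀`) or (`z_k ≤ 0` and `τ₀ ≤ τ_k`) — the children's
`δ`-signs are ordered and `τ = A_F/M_F` is non-decreasing, `τ₀ = τ_κ` its value at the sign change — then `Σ_{k<t} τ_k z_k ≤ τ₀·Σ_{k<t} z_k`.
[cite: KozmaNitzan2024, Question 8 (§5.5 p. 36)] -/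
theorem kImp_cheb (t : ℕ) (τ z : ℕ → ℝ) (τ₀ : ℝ)
    (h : ∀ k < t, (0 ≤ z k ∧ τ k ≤ τ₀) ∨ (z k ≤ 0 ∧ τ₀ ≤ τ k)) :
    ∑ k ∈ range t, τ k * z k ≤ τ₀ * ∑ k ∈ range t, z k := by
  rw [mul_sum]
  apply sum_le_sum
  intro k hk
  exact kImp_term (τ k) τ₀ (z k) (h k (mem_range.mp hk))

/-- **(X1) at a θ-monotone importer.**  With the importer inequality `Σ_{k<t} z_k < −e`, `e ≥ 0` (the own supply `e_t/p_t`) and `τ₀ ≥ 0`, the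
Chebyshev bound gives `X^δ_t = Σ_{k<t} τ_k z_k ≤ −τ₀·e ≤ 0`.
[cite: KozmaNitzan2024, Question 8 (§5.5 p. 36)] -/
theorem kImp_assembly (t : ℕ) (τ z : ℕ → ℝ) (τ₀ e : ℝ)
    (h : ∀ k < t, (0 ≤ z k ∧ τ k ≤ τ₀) ∨ (z k ≤ 0 ∧ τ₀ ≤ τ k))
    (himp : ∑ k ∈ range t, z k < -e) (he : 0 ≤ e) (hτ₀ : 0 ≤ τ₀) :
    ∑ k ∈ range t, τ k * z k ≤ 0 := by
  have h1 := kImp_cheb t τ z τ₀ h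
  have h2 : τ₀ * ∑ k ∈ range t, z k ≤ τ₀ * (-e) := mul_le_mul_of_nonneg_left himp.le hτ₀
  nlinarith

/-- **Two-level Chebyshev, termwise.**  If either `0 ≤ m` and `τ ≤ τhi`, or `m ≤ 0` and `τlo ≤ τ`, then
`τ·m ≤ τhi·max(m,0) + τlo·min(m,0)`: positive children are weighted at most by the largest early share `τ* = τhi`, negative
children at least by the smallest late share `τ_* = τlo` (gen-42 FINDING §3, the (S1′) reduction).
[cite: KozmaNitzan2024, Question 8 (§5.5 p. 36)] -/
theorem kImp_term2 (τ τhi τlo m : ℝ) (h : (0 ≤ m ∧ τ ≤ τhi) ∨ (m ≤ 0 ∧ τlo ≤ τ)) :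
    τ * m ≤ τhi * max m 0 + τlo * min m 0 := by
  rcases h with ⟨hm, hτ⟩ | ⟨hm, hτ⟩
  · rw [max_eq_left hm, min_eq_right hm, mul_zero, add_zero]
    exact mul_le_mul_of_nonneg_right hτ hm
  · rw [max_eq_right hm, min_eq_left hm, mul_zero, zero_add]
    exact mul_le_mul_of_nonpos_right hτ hm

/-- **Two-level Chebyshev (finite-sum form).**  Under the termwise hypothesis for every child `k < t`:
`Σ_{k<t} τ_k m_k ≤ τhi·Σ_{k<t} max(m_k,0) + τlo·Σ_{k<t} min(m_k,0) = τ*·P − τ_*·N`.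
[cite: KozmaNitzan2024, Question 8 (§5.5 p. 36)] -/
theorem kImp_cheb2 (t : ℕ) (τ m : ℕ → ℝ) (τhi τlo : ℝ)
    (h : ∀ k < t, (0 ≤ m k ∧ τ k ≤ τhi) ∨ (m k ≤ 0 ∧ τlo ≤ τ k)) :
    ∑ k ∈ range t, τ k * m k ≤ τhi * ∑ k ∈ range t, max (m k) 0 + τlo * ∑ k ∈ range t, min (m k) 0 := by
  rw [mul_sum, mul_sum, ← sum_add_distrib]
  apply sum_le_sum
  intro k hk
  exact kImp_term2 (τ k) τhi τlo (m k) (h k (mem_range.mp hk))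

/-- **(X1) at an importer from (S1′).**  With `P = Σ max(m_k,0) ≥ 0`, `N = −Σ min(m_k,0) ≥ 0` and the two-level Chebyshev bound
`X ≤ τhi·P − τlo·N`, the condition (S1′) `τhi·P ≤ τlo·N` gives `X ≤ 0`; and (S1) `(τhi − τlo)·P ≤ τlo·e` together with the importer
inequality `P − N < −e` implies (S1′).
[cite: KozmaNitzan2024, Question 8 (§5.5 p. 36)] -/
theorem kImp_assembly2 (X P N τhi τlo e : ℝ) (hX : X ≤ τhi * P - τlo * N) (hτlo : 0 ≤ τlo)
    (h : τhi * P ≤ τlo * N ∨ ((τhi - τlo) * P ≤ τlo * e ∧ P - N < -e)) : X ≤ 0 := by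
  rcases h with h1 | ⟨h2, himp⟩
  · linarith
  · have h3 : τlo * (P + e) ≤ τlo * N := mul_le_mul_of_nonneg_left (by linarith) hτlo
    nlinarith

end PocketCert

end Summit.CriticalPhenomena.PercolationContinuityZ3.Theorems
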